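import Mathlib
import HarnessLib
import Literature.Computability.AlgebraicComplexity.ArithCircuit
import Literature.Computability.AlgebraicComplexity.CircuitDepth
import Literature.Computability.AlgebraicComplexity.StandardFamilies
import Literature.Computability.AlgebraicComplexity.RealTauConjectureDepthFour
import Literature.Computability.AlgebraicComplexity.DepthThreeChasmCircuits
import Literature.Computability.Complexity.Circuit
import Literature.Barriers.PneNP.RelativizedCircuitSizeCounting
import Summits.ValiantsHypothesis.ValiantsHypothesis.Theorems.SuccinctLiftCircuitCodes

/-!
# Succinct lift — w10b: the budget-sensitive description count and the width-pinned notch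

Route `route-ValiantsHypothesis-SuccinctLift` (lens 2: natural-proofs / succinctness axis), generation 8; companion of
`SuccinctLiftNaturalColumn.lean` (which turns hardness at a notch of the description dial into an algebraically
natural proof against the notch's finite class, of degree `≤ |class|`).  This file supplies the COUNT that makes the
degree budget-sensitive:

* `ncard_b2Computed_le` — at most `descCount w s = (s+1) · (48 (w+s+1)²)^s · (w+s+1)` Boolean functions on `w`
  address bits have `B₂`-descriptions with `≤ s` gates (a fan-in-two sharpening of the tree's
  `Literature.Barriers.PneNP.Wilson.card_computedFns_le`, whose unbounded-fan-in bound `2^{(w+s+3)(s+4)²}` is useless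
  here); `descCount_le_pow : descCount w s ≤ (7 (w+s+1))^(2s+2)`;
* `PinnedClass Δ n c w s` — the notch of the dial with the address width PINNED to `w` and budget `s`
  (the route's `SuccinctClass β Δ n c` is `⋃_w PinnedClass Δ n c w (β n c)`), and
  `ncard_pinnedClass_le : |PinnedClass Δ n c w s| ≤ (2^w + 1) · descCount w s` — a member is determined by the length
  of its witness's code word and the description circuit (`encodeArithCircuit_injective`; `encodeCkt₂_inj`;
  `exists_addr_eq`).
At `s = n + c`, `w = O(c log n)` this is `2^{O(n log n)}`, polynomial in `N_n = C(n² + n, n) ≥ (n+1)^n`; at the top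
notch `s = n^c + c` it is `2^{Θ(n^c log n)}` (numbers in the route file §Gen 8).

References: Wilson 1985 (`Wilson1985`, FACT p. 176), Arora–Barak 2009 (`AroraBarakCC2009`, §6.1), Chen–Kabanets 2012
(`ChenKabanets2012`, Def. 2.1), Jansen–Santhanam 2011 (`JansenSanthanam2011`, §1).
-/

namespace Summit.ValiantsHypothesis.ValiantsHypothesis.Theorems.SuccinctLift

open Literature.Computability.AlgebraicComplexity Literature.Computability.Complexity Computability
open MvPolynomial ArithCircuit

noncomputable section

/-! ### The budget-sensitive count: descriptions, and the width-pinned notch -/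

section DescriptionCount

open Literature.Barriers.PneNP

variable {w s : ℕ}

/-- Code of a fan-in-`≤ 2` gate: fan-in (`< 3`), padded truth table on two inputs, padded wire table on two
argument slots (a fan-in-two sharpening of the tree's `Wilson.GateCode`). [cite: Wilson1985, FACT p. 176] -/
abbrev GateCode₂ (w s : ℕ) : Type :=
  Fin 3 × ((Fin 2 → Bool) → Bool) × (Fin 2 → Fin (w + s + 1))

/-- Code of a `B₂`-circuit with `≤ s` gates on `w` inputs: number of gates, gate codes, output wire.
[cite: Wilson1985, FACT p. 176] -/
abbrev CktCode₂ (w s : ℕ) : Type :=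
  Fin (s + 1) × (Fin s → GateCode₂ w s) × Fin (w + s + 1)

/-- Code of a gate (wires coded by the tree's `Wilson.encodeWire`). [cite: Wilson1985, FACT p. 176] -/
def encodeGate₂ (w s : ℕ) (g : Gate (Fin w)) : GateCode₂ w s :=
  (⟨min g.arity 2, by omega⟩,
    fun u => if h : g.arity ≤ 2 then g.op (fun a => u (a.castLE h)) else false,
    fun b => if h : (b : ℕ) < g.arity then Wilson.encodeWire w s (g.args ⟨b, h⟩) else ⟨0, by omega⟩)

/-- Code of a circuit. [cite: Wilson1985, FACT p. 176] -/
def encodeCkt₂ (w s : ℕ) (c : Circuit (Fin w)) : CktCode₂ w s :=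
  (⟨min c.gates.length s, by omega⟩,
    fun j => if h : (j : ℕ) < c.gates.length then encodeGate₂ w s (c.gates[(j : ℕ)]) else
      encodeGate₂ w s ⟨0, fun _ => false, Fin.elim0⟩,
    Wilson.encodeWire w s c.output)

/-- Two fan-in-`≤ 2` gates with the same code, admissible at a position `< s`, are equal.
[cite: Wilson1985, FACT p. 176] -/
theorem encodeGate₂_inj {g g' : Gate (Fin w)} (ha : g.arity ≤ 2) (ha' : g'.arity ≤ 2)
    (hw : ∀ a m, g.args a = .inr m → m < s) (hw' : ∀ a m, g'.args a = .inr m → m < s)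
    (h : encodeGate₂ w s g = encodeGate₂ w s g') : g = g' := by
  obtain ⟨k, op, args⟩ := g
  obtain ⟨k', op', args'⟩ := g'
  simp only at ha ha' hw hw'
  simp only [encodeGate₂, Prod.mk.injEq, Fin.mk.injEq] at h
  obtain ⟨hk, hops, hargs⟩ := h
  obtain rfl : k = k' := by
    rw [Nat.min_eq_left ha, Nat.min_eq_left ha'] at hk
    exact hk
  obtain rfl : op = op' := by
    funext u
    have := congrFun hops (fun b => if hb : (b : ℕ) < k then u ⟨b, hb⟩ else false)
    simp only [ha, ↓reduceDIte] at this
    convert this using 2 <;>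
    · funext a
      simp [Fin.castLE, a.isLt]
  obtain rfl : args = args' := by
    funext a
    have := congrFun hargs ⟨a, by omega⟩
    simp only [a.isLt, ↓reduceDIte, Fin.eta] at this
    exact Wilson.encodeWire_inj (hw a) (hw' a) this
  rfl

/-- **The code determines the circuit** (over `B₂`, at most `s` gates). [cite: Wilson1985, FACT p. 176] -/
theorem encodeCkt₂_inj {c c' : Circuit (Fin w)} (hc : c.IsOver B2) (hcs : c.size ≤ s)
    (hc' : c'.IsOver B2) (hcs' : c'.size ≤ s) (h : encodeCkt₂ w s c = encodeCkt₂ w s c') :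
    c = c' := by
  obtain ⟨gs, out, wf, wfo⟩ := c
  obtain ⟨gs', out', wf', wfo'⟩ := c'
  simp only [encodeCkt₂, Prod.mk.injEq, Fin.mk.injEq] at h
  obtain ⟨hlen, hgates, hout⟩ := h
  have hl : gs.length ≤ s := hcs
  have hl' : gs'.length ≤ s := hcs'
  rw [Nat.min_eq_left hl, Nat.min_eq_left hl'] at hlen
  obtain rfl : gs = gs' := by
    refine List.ext_getElem hlen fun j hj hj' => ?_
    have hcode := congrFun hgates ⟨j, by omega⟩
    simp only [hj, ↓reduceDIte, hj'] at hcode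
    have hm : gs[j] ∈ gs := List.getElem_mem hj
    have hm' : gs'[j] ∈ gs' := List.getElem_mem hj'
    have ha : (gs[j]).arity ≤ 2 := hc _ hm
    have ha' : (gs'[j]).arity ≤ 2 := hc' _ hm'
    refine encodeGate₂_inj ha ha' (fun a m ham => ?_) (fun a m ham => ?_) hcode
    · exact (wf j hj a m ham).trans_le (by omega)
    · exact (wf' j hj' a m ham).trans_le (by omega)
  obtain rfl : out = out' :=
    Wilson.encodeWire_inj (fun m hm => (wfo m hm).trans_le hl) (fun m hm => (wfo' m hm).trans_le hl) hout
  rfl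

/-- The description count: `(s+1) · (48 (w+s+1)²)^s · (w+s+1)`. [folklore] -/
def descCount (w s : ℕ) : ℕ := (s + 1) * ((48 * (w + s + 1) ^ 2) ^ s * (w + s + 1))

/-- `|CktCode₂ w s| = descCount w s`. [folklore] -/
theorem card_cktCode₂ (w s : ℕ) : Fintype.card (CktCode₂ w s) = descCount w s := by
  simp only [CktCode₂, GateCode₂, descCount, Fintype.card_prod, Fintype.card_fin, Fintype.card_pi,
    Fintype.card_bool, Finset.prod_const, Finset.card_univ]
  norm_num [← mul_assoc]

/-- A clean upper bound: `descCount w s ≤ (7 (w+s+1))^(2s+2)`. [folklore] -/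
theorem descCount_le_pow (w s : ℕ) : descCount w s ≤ (7 * (w + s + 1)) ^ (2 * s + 2) := by
  unfold descCount
  set N := w + s + 1 with hN
  have h1 : s + 1 ≤ N := by omega
  calc (s + 1) * ((48 * N ^ 2) ^ s * N) ≤ N * ((49 * N ^ 2) ^ s * N) := by gcongr; norm_num
    _ = 7 ^ (2 * s) * N ^ (2 * s + 2) := by
        rw [show (49 : ℕ) = 7 ^ 2 by norm_num, mul_pow, ← pow_mul, ← pow_mul]
        ring
    _ ≤ 7 ^ (2 * s + 2) * N ^ (2 * s + 2) := by gcongr <;> omega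
    _ = (7 * N) ^ (2 * s + 2) := by rw [mul_pow]

/-- The Boolean functions on `w` address bits with a `B₂`-description of at most `s` gates.
[cite: AroraBarakCC2009, §6.1] -/
def B2Computed (w s : ℕ) : Set ((Fin w → Bool) → Bool) :=
  {F | ∃ D : Circuit (Fin w), D.IsOver B2 ∧ D.size ≤ s ∧ D.Computes F}

/-- **Budget count**: at most `descCount w s = (s+1)(48(w+s+1)²)^s(w+s+1)` functions on `w` bits have
`B₂`-descriptions with `≤ s` gates (fan-in-two sharpening of `Wilson.card_computedFns_le`).
[cite: Wilson1985, FACT p. 176] -/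
theorem ncard_b2Computed_le (w s : ℕ) : (B2Computed w s).ncard ≤ descCount w s := by
  classical
  have hch : ∀ F ∈ B2Computed w s, ∃ D : Circuit (Fin w), D.IsOver B2 ∧ D.size ≤ s ∧ D.Computes F :=
    fun F hF => hF
  haveI : Nonempty (Circuit (Fin w)) := ⟨Circuit.const _ false⟩
  choose! ckt hckt using hch
  have hinj : Set.InjOn (fun F => encodeCkt₂ w s (ckt F)) (B2Computed w s) := by
    intro F hF G hG hFG
    have hc := encodeCkt₂_inj (hckt F hF).1 (hckt F hF).2.1 (hckt G hG).1 (hckt G hG).2.1 hFG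
    funext v
    rw [← (hckt F hF).2.2 v, ← (hckt G hG).2.2 v, hc]
  have h := Set.ncard_le_ncard_of_injOn _ (fun _ _ => Set.mem_univ _) hinj Set.finite_univ
  rwa [Set.ncard_univ, Nat.card_eq_fintype_card, card_cktCode₂] at h

/-- Every address `i < 2^w` is the number of some `w`-bit string (little-endian). [folklore] -/
theorem exists_addr_eq {w i : ℕ} (hi : i < 2 ^ w) :
    ∃ a : Fin w → Bool, (∑ t : Fin w, if a t then 2 ^ (t : ℕ) else 0) = i := by
  obtain ⟨f, hf⟩ := finFunctionFinEquiv.surjective (⟨i, hi⟩ : Fin (2 ^ w))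
  refine ⟨fun t => decide ((f t : ℕ) = 1), ?_⟩
  have h := congrArg Fin.val hf
  rw [finFunctionFinEquiv_apply] at h
  simp only at h
  rw [← h]
  refine Finset.sum_congr rfl fun t _ => ?_
  have h2 : (f t : ℕ) < 2 := (f t).isLt
  by_cases h1 : (f t : ℕ) = 1
  · simp [h1]
  · have h0 : (f t : ℕ) = 0 := by omega
    simp [h0]

/-- The WIDTH-PINNED notch: as `SuccinctClass`, but the address width is a parameter `w` (not `∃ w`) and the
description budget a number `s`. [cite: ChenKabanets2012, Def. 2.1] -/
def PinnedClass (Δ : ℕ → ℕ) (n c w s : ℕ) : Set (MvPolynomial (Fin n × Fin n) ℂ) :=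
  {f | ∃ C : ArithCircuit ℤ (Fin (n * n)), ∃ C' : ArithCircuit ℂ (Fin n × Fin n),
    C' = (C.map (Int.castRingHom ℂ)).rename ⇑(finProdFinEquiv (m := n) (n := n)).symm ∧
    C.HasSignConstants ∧ C'.Computes f ∧ C'.productDepth ≤ Δ n ∧
    C'.edgeSize ≤ n ^ c + c ∧
    (encodeArithCircuit (n * n) C).length ≤ 2 ^ w ∧
      ∃ D : Literature.Computability.Complexity.Circuit (Fin w),
        D.IsOver Literature.Computability.Complexity.B2 ∧ D.size ≤ s ∧
          D.Computes fun a =>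
            (encodeArithCircuit (n * n) C).getD (∑ t : Fin w, if a t then 2 ^ (t : ℕ) else 0) false}

/-- **The width-pinned notch is small**: at most `(2^w + 1) · descCount w s` members — the member is determined by
the length of the code word of its witness and the description circuit (the code determines the circuit,
`encodeArithCircuit_injective`; the description determines the code below length `2^w`, `exists_addr_eq`).
[cite: JansenSanthanam2011, §1] -/
theorem ncard_pinnedClass_le (Δ : ℕ → ℕ) (n c w s : ℕ) :
    (PinnedClass Δ n c w s).ncard ≤ (2 ^ w + 1) * descCount w s := by
  classical
  have hch : ∀ f ∈ PinnedClass Δ n c w s, ∃ C : ArithCircuit ℤ (Fin (n * n)),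
      ((C.map (Int.castRingHom ℂ)).rename ⇑(finProdFinEquiv (m := n) (n := n)).symm).Computes f ∧
      (encodeArithCircuit (n * n) C).length ≤ 2 ^ w ∧
      ∃ D : Literature.Computability.Complexity.Circuit (Fin w),
        D.IsOver Literature.Computability.Complexity.B2 ∧ D.size ≤ s ∧
          D.Computes fun a =>
            (encodeArithCircuit (n * n) C).getD (∑ t : Fin w, if a t then 2 ^ (t : ℕ) else 0) false := by
    rintro f ⟨C, C', rfl, -, h3, -, -, hw, D, hD1, hD2, hD3⟩
    exact ⟨C, h3, hw, D, hD1, hD2, hD3⟩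
  haveI : Nonempty (ArithCircuit ℤ (Fin (n * n))) := ⟨⟨[], .const 0⟩⟩
  haveI : Nonempty (Literature.Computability.Complexity.Circuit (Fin w)) := ⟨Circuit.const _ false⟩
  choose! wit hwit hlen hdesc using hch
  choose! dsc hdsc using hdesc
  let key : MvPolynomial (Fin n × Fin n) ℂ → Fin (2 ^ w + 1) × CktCode₂ w s := fun f =>
    (⟨min (encodeArithCircuit (n * n) (wit f)).length (2 ^ w), by omega⟩, encodeCkt₂ w s (dsc f))
  have hinj : Set.InjOn key (PinnedClass Δ n c w s) := by
    intro f hf g hg hfg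
    simp only [key, Prod.mk.injEq, Fin.mk.injEq] at hfg
    obtain ⟨hl, hcode⟩ := hfg
    rw [Nat.min_eq_left (hlen f hf), Nat.min_eq_left (hlen g hg)] at hl
    have hD : dsc f = dsc g :=
      encodeCkt₂_inj (hdsc f hf).1 (hdsc f hf).2.1 (hdsc g hg).1 (hdsc g hg).2.1 hcode
    have hword : encodeArithCircuit (n * n) (wit f) = encodeArithCircuit (n * n) (wit g) := by
      refine List.ext_getElem hl fun i hi hi' => ?_
      obtain ⟨a, ha⟩ := exists_addr_eq (w := w) (lt_of_lt_of_le hi (hlen f hf))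
      have h1 := (hdsc f hf).2.2 a
      have h2 := (hdsc g hg).2.2 a
      rw [hD] at h1
      have h12 := h1.symm.trans h2
      simp only [ha] at h12
      rw [List.getD_eq_getElem _ _ hi, List.getD_eq_getElem _ _ hi'] at h12
      exact h12
    have hC : wit f = wit g := encodeArithCircuit_injective _ hword
    have ef := hwit f hf
    have eg := hwit g hg
    unfold ArithCircuit.Computes at ef eg
    rw [← ef, ← eg, hC]
  have h := Set.ncard_le_ncard_of_injOn key (fun _ _ => Set.mem_univ _) hinj Set.finite_univ
  rwa [Set.ncard_univ, Nat.card_eq_fintype_card, Fintype.card_prod, Fintype.card_fin, card_cktCode₂] at h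

end DescriptionCount

end

end Summit.ValiantsHypothesis.ValiantsHypothesis.Theorems.SuccinctLift
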